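import Summits.AtomisticToContinuum.Crystallization.Theorems.PalmUnimodularRigidityBenjaminiSchrammLimit

/-!
# Route `FrustratedLawDichotomy`, item `TexturedLawTransfer` (stmt-AtomisticToContinuum-27625),
# line «truncated-bs», stub S2 `stub_localLimitEngine`: the point-stationary local limit of
# uniformly rooted truncated windows

The Benjamini–Schramm / objective-method engine of item `BenjaminiSchrammLimit`
(`Theorems/PalmUnimodularRigidityBenjaminiSchrammLimit*.lean`: empirical rooted laws on the compact
space of rooted `δ`-hard-core configurations, Prokhorov, exact finite mass transport passing to the
limit, continuity of the root energy) run on an ARBITRARY sequence of finite `δ`-separated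
configurations `w m : Fin (n m) → ℝ³` ("windows"), uniformly rooted over ALL their points — which is
exactly point-stationary at every finite stage, whether or not the window is a ground state — with
two additions needed by the line «truncated-bs» of `TexturedLawTransfer`:

* the energy clause is an INEQUALITY: if eventually `𝓔(w m) ≤ c · n m` then `E_P[rootEnergy] ≤ c`
  (`integral_rootEnergy_emp` + weak convergence against the bounded continuous root energy);
* the support clause: if, for every depth `M`, the fraction of window points at distance
  `> r m - M` from a centre `z m` vanishes (`t m → 0`), then `P`-a.e. configuration is, for every
  `M`, `m₀` and `ε > 0`, locally `(M, ε)`-matched by the window `w m` recentred at a DEEP point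
  `a` (`dist (w m a) (z m) + M ≤ r m`) of some stage `m ≥ m₀` — closed-set portmanteau for the
  closure of the set of deep recentred windows (`measure_compl_eq_zero_of_tendsto`,
  `emp_le_ofReal`) and `tendsto_iff_locallyMatches` along an approximating sequence.

Main results: `exists_windowLimit` (abstract windows) and the registered stub
`stub_localLimitEngine` (statement verbatim = `stub_localLimitEngine` of the skeleton
`Lines/truncated-bs.lean` of `TexturedLawTransfer`): windows `B(x_{i_m}, r_m) ∩ X_m` of
`δ`-separated configurations with thin `L_m`-shells, re-indexed increasingly
(`Finset.orderEmbOfFin`), fed to `exists_windowLimit`; the double-sum energy hypothesis is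
`2 · 𝓔(window)` (`sum_sum_map_eq_two_mul_interactionEnergy`) and local matching at integer depth
`⌈max R 0⌉₊` is unpacked into the two displayed clauses. No new definitions.
-/

noncomputable section

open MeasureTheory Set Filter Metric TopologicalSpace ProbabilityTheory
open scoped Topology ENNReal NNReal BoundedContinuousFunction

namespace Summit.AtomisticToContinuum.Crystallization.Theorems.FrustratedLawDichotomyLocalLimitEngine

open Literature.Probability.Process Literature.Probability.Process.LocalConfig
open Literature.MathematicalPhysics.StatisticalMechanics
open Summit.AtomisticToContinuum.Crystallization.Theorems.BenjaminiSchrammLimit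

variable {δ : ℝ}

open scoped Classical in
/-- Mass bound for the uniformly rooted empirical law of a finite configuration: if every particle
whose rooted configuration lies in `U` belongs to a set `G` of at most `t · N` particles, the
empirical mass of `U` is `≤ t`. [folklore] -/
theorem emp_le_ofReal {N : ℕ} (hN : N ≠ 0) {w : Fin N → EuclideanSpace ℝ (Fin 3)}
    {hsep : ∀ j k, j ≠ k → δ ≤ dist (w j) (w k)}
    {U : Set (RootedHardCoreConfig (EuclideanSpace ℝ (Fin 3)) δ)} (hU : MeasurableSet U)
    {t : ℝ} (ht : 0 ≤ t) (G : Finset (Fin N))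
    (hGU : ∀ a : Fin N, RootedHardCoreConfig.ofFinite w hsep a ∈ U → a ∈ G)
    (hcard : (G.card : ℝ) ≤ t * N) :
    (((N : ℕ) : ℝ≥0∞)⁻¹ • ∑ a : Fin N,
        (Measure.dirac (RootedHardCoreConfig.ofFinite w hsep a) :
          Measure (RootedHardCoreConfig (EuclideanSpace ℝ (Fin 3)) δ))) U ≤ ENNReal.ofReal t := by
  rw [emp_apply hU]
  have hne : ((N : ℝ≥0∞)⁻¹ * ((Finset.univ.filter fun a : Fin N =>
      RootedHardCoreConfig.ofFinite w hsep a ∈ U).card : ℕ)) ≠ ⊤ :=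
    ENNReal.mul_ne_top (ENNReal.inv_ne_top.2 (Nat.cast_ne_zero.2 hN)) (ENNReal.natCast_ne_top _)
  have hle : ((Finset.univ.filter fun a : Fin N =>
      RootedHardCoreConfig.ofFinite w hsep a ∈ U).card : ℝ) ≤ G.card :=
    Nat.cast_le.2 (Finset.card_le_card fun a ha => hGU a (Finset.mem_filter.1 ha).2)
  rw [ENNReal.le_ofReal_iff_toReal_le hne ht, ENNReal.toReal_mul, ENNReal.toReal_inv,
    ENNReal.toReal_natCast, ENNReal.toReal_natCast,
    inv_mul_le_iff₀ (Nat.cast_pos.2 (Nat.pos_of_ne_zero hN))]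
  linarith

/-- Closed-set portmanteau along a subsequence: if the empirical masses of the complement of a
closed set `F` are eventually `≤ t m` with `t m → 0`, every weak subsequential limit gives `Fᶜ`
mass `0`. [folklore] -/
theorem measure_compl_eq_zero_of_tendsto [Fact (0 < δ)]
    {Qs : ℕ → ProbabilityMeasure (RootedHardCoreConfig (EuclideanSpace ℝ (Fin 3)) δ)}
    {Q : ProbabilityMeasure (RootedHardCoreConfig (EuclideanSpace ℝ (Fin 3)) δ)} {ψ : ℕ → ℕ}
    (hψ : StrictMono ψ) (hlim : Tendsto (Qs ∘ ψ) atTop (𝓝 Q))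
    {F : Set (RootedHardCoreConfig (EuclideanSpace ℝ (Fin 3)) δ)} (hF : IsClosed F)
    {t : ℕ → ℝ} (ht : Tendsto t atTop (𝓝 0))
    (hle : ∀ᶠ m in atTop,
      (Qs m : Measure (RootedHardCoreConfig (EuclideanSpace ℝ (Fin 3)) δ)) Fᶜ ≤
        ENNReal.ofReal (t m)) :
    (Q : Measure (RootedHardCoreConfig (EuclideanSpace ℝ (Fin 3)) δ)) Fᶜ = 0 := by
  have h1 := ProbabilityMeasure.le_liminf_measure_open_of_tendsto hlim hF.isOpen_compl
  have h2 : atTop.liminf (fun j =>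
        ((Qs ∘ ψ) j : Measure (RootedHardCoreConfig (EuclideanSpace ℝ (Fin 3)) δ)) Fᶜ) ≤
      atTop.liminf (fun j => ENNReal.ofReal (t (ψ j))) :=
    liminf_le_liminf (hψ.tendsto_atTop.eventually hle)
  have h3 : Tendsto (fun j => ENNReal.ofReal (t (ψ j))) atTop (𝓝 0) := by
    have := ENNReal.tendsto_ofReal (ht.comp hψ.tendsto_atTop)
    rwa [ENNReal.ofReal_zero] at this
  exact nonpos_iff_eq_zero.1 ((h1.trans h2).trans h3.liminf_eq.le)

/-- **The point-stationary local limit of uniformly rooted windows.** For `δ > 0` and any sequence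
of finite `δ`-separated configurations `w m : Fin (n m) → ℝ³` (`n m ≠ 0`), uniformly rooted over
all their points, a weak subsequential limit of the empirical rooted laws exists on the compact
space of rooted `δ`-hard-core configurations and, pushed to `Measure (Measure ℝ³)` along
`S ↦ count|S`, is a probability law `P` which is (i) a.s. rooted `δ`-hard-core, (ii)
POINT-STATIONARY (uniform rooting of a finite configuration is exactly unimodular, and the
mass-transport identity passes to the limit), (iii) has mean root energy `≤ c` whenever eventually
`𝓔(w m) ≤ c · n m`, and (iv) if for every depth `M` the fraction of points of `w m` farther than
`r m - M` from the centre `z m` is eventually `≤ t m → 0`, then `P`-a.e. configuration is, for all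
`M`, `m₀`, `ε > 0`, locally `(M, ε)`-matched by `w m` recentred at a point `a` with
`dist (w m a) (z m) + M ≤ r m`, for some `m ≥ m₀`. [folklore] -/
theorem exists_windowLimit (hδ : 0 < δ) (n : ℕ → ℕ) (hn : ∀ m, n m ≠ 0)
    (w : (m : ℕ) → Fin (n m) → EuclideanSpace ℝ (Fin 3))
    (hsep : ∀ (m : ℕ) (a b : Fin (n m)), a ≠ b → δ ≤ dist (w m a) (w m b))
    (z : ℕ → EuclideanSpace ℝ (Fin 3)) (r t : ℕ → ℝ) (ht0 : ∀ m, 0 ≤ t m)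
    (ht : Tendsto t atTop (𝓝 0))
    (hthin : ∀ M : ℕ, ∀ᶠ m in atTop,
      ((Finset.univ.filter fun a : Fin (n m) => r m < dist (w m a) (z m) + M).card : ℝ) ≤
        t m * n m) :
    ∃ P : Measure (Measure (EuclideanSpace ℝ (Fin 3))), IsProbabilityMeasure P ∧
      (∀ᵐ μ ∂P, IsRootedHardCore δ μ) ∧ IsPointStationaryLaw P ∧
      (∀ c : ℝ, (∀ᶠ m in atTop, interactionEnergy lennardJones (w m) ≤ c * n m) →
        (∫ μ, rootEnergy lennardJones μ ∂P) ≤ c) ∧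
      (∀ᵐ μ ∂P, ∀ M m₀ : ℕ, ∀ ε : ℝ, 0 < ε → ∃ m : ℕ, m₀ ≤ m ∧ ∃ a : Fin (n m),
        dist (w m a) (z m) + M ≤ r m ∧
        LocallyMatches (M : ℝ) ε (atoms μ) (Set.range fun b => w m b - w m a)) := by
  classical
  haveI : Fact (0 < δ) := ⟨hδ⟩
  haveI : ∀ m, NeZero (n m) := fun m => ⟨hn m⟩
  have hinj : ∀ m, Function.Injective (w m) := fun m a b hab => by
    by_contra h
    have h1 := hsep m a b h
    rw [hab, dist_self] at h1
    exact absurd h1 (not_le.2 hδ)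
  -- the empirical rooted laws of the windows, on the compact space of rooted hard-core configurations
  set Qs : ℕ → ProbabilityMeasure (RootedHardCoreConfig (EuclideanSpace ℝ (Fin 3)) δ) := fun m =>
    ⟨((n m : ℕ) : ℝ≥0∞)⁻¹ • ∑ a : Fin (n m),
      (Measure.dirac (RootedHardCoreConfig.ofFinite (w m) (hsep m) a) :
        Measure (RootedHardCoreConfig (EuclideanSpace ℝ (Fin 3)) δ)), isProbabilityMeasure_emp⟩
    with hQs_def
  -- Prokhorov
  obtain ⟨Q, ψ, hψ, hlim⟩ := CompactSpace.tendsto_subseq Qs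
  set e : RootedHardCoreConfig (EuclideanSpace ℝ (Fin 3)) δ → Measure (EuclideanSpace ℝ (Fin 3)) :=
    fun S => (S.1 : LocalConfig (EuclideanSpace ℝ (Fin 3))).toMeasure with he_def
  have hE : MeasurableEmbedding e := measurableEmbedding_toMeasure (EuclideanSpace ℝ (Fin 3))
  haveI := isSFiniteKernel_toMeasure (E := EuclideanSpace ℝ (Fin 3)) (δ := δ)
  -- exact finite mass transport at every stage, passing to the limit
  have hinv := map_reroot_compProd_eq_of_tendsto hlim fun j => map_reroot_compProd_emp (hinj (ψ j))
  refine ⟨(Q : Measure (RootedHardCoreConfig (EuclideanSpace ℝ (Fin 3)) δ)).map e,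
    Measure.isProbabilityMeasure_map hE.measurable.aemeasurable, ?_, ?_, ?_, ?_⟩
  · -- (i) a.s. a rooted `δ`-hard-core counting measure
    exact (hE.ae_map_iff).2 (Eventually.of_forall fun S =>
      (isRootedHardCore_toMeasure_iff δ S.1).2 S.2)
  · -- (ii) point-stationarity
    exact isPointStationaryLaw_map_toMeasure hinv
  · -- (iii) the mean root energy
    intro c hc
    rw [hE.integral_map]
    set H : RootedHardCoreConfig (EuclideanSpace ℝ (Fin 3)) δ →ᵇ ℝ :=
      BoundedContinuousFunction.mkOfCompact
        ⟨fun S => (∫ y, lennardJones ‖y‖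
            ∂((S.1 : LocalConfig (EuclideanSpace ℝ (Fin 3))).toMeasure)) / 2,
          (continuous_integral_lennardJones_toMeasure hδ).div_const 2⟩ with hH_def
    have hlimH := (ProbabilityMeasure.tendsto_iff_forall_integral_tendsto.1 hlim) H
    have hev : ∀ᶠ j in atTop,
        ∫ S, H S ∂(Qs (ψ j) : Measure (RootedHardCoreConfig (EuclideanSpace ℝ (Fin 3)) δ)) ≤ c := by
      filter_upwards [hψ.tendsto_atTop.eventually hc] with j hj
      change ∫ S, (∫ y, lennardJones ‖y‖
          ∂((S.1 : LocalConfig (EuclideanSpace ℝ (Fin 3))).toMeasure)) / 2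
        ∂(((n (ψ j) : ℕ) : ℝ≥0∞)⁻¹ • ∑ a : Fin (n (ψ j)),
          (Measure.dirac (RootedHardCoreConfig.ofFinite (w (ψ j)) (hsep (ψ j)) a) :
            Measure (RootedHardCoreConfig (EuclideanSpace ℝ (Fin 3)) δ))) ≤ c
      rw [integral_rootEnergy_emp (hinj _),
        div_le_iff₀ (Nat.cast_pos.2 (Nat.pos_of_ne_zero (hn _)))]
      exact hj
    exact le_of_tendsto hlimH hev
  · -- (iv) the support: a.e. configuration is a local limit of DEEP recentred windows
    have key : ∀ M m₀ : ℕ, (Q : Measure (RootedHardCoreConfig (EuclideanSpace ℝ (Fin 3)) δ))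
        (closure {S | ∃ m : ℕ, m₀ ≤ m ∧ ∃ a : Fin (n m), dist (w m a) (z m) + M ≤ r m ∧
          S = RootedHardCoreConfig.ofFinite (w m) (hsep m) a})ᶜ = 0 := by
      intro M m₀
      refine measure_compl_eq_zero_of_tendsto hψ hlim isClosed_closure ht ?_
      filter_upwards [hthin M, eventually_ge_atTop m₀] with m hm hm₀
      refine emp_le_ofReal (hn m) isClosed_closure.isOpen_compl.measurableSet (ht0 m) _
        (fun a ha => Finset.mem_filter.2 ⟨Finset.mem_univ _, not_le.1 fun hdeep =>
          ha (subset_closure ⟨m, hm₀, a, hdeep, rfl⟩)⟩) hm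
    have hall : ∀ᵐ S ∂(Q : Measure (RootedHardCoreConfig (EuclideanSpace ℝ (Fin 3)) δ)),
        ∀ M m₀ : ℕ, S ∈ closure {S | ∃ m : ℕ, m₀ ≤ m ∧ ∃ a : Fin (n m),
          dist (w m a) (z m) + M ≤ r m ∧ S = RootedHardCoreConfig.ofFinite (w m) (hsep m) a} := by
      refine ae_all_iff.2 fun M => ae_all_iff.2 fun m₀ => ?_
      rw [ae_iff]
      exact key M m₀
    refine (hE.ae_map_iff).2 ?_
    filter_upwards [hall] with S hS
    intro M m₀ ε hε
    obtain ⟨u, huA, hu⟩ := mem_closure_iff_seq_limit.1 (hS M m₀)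
    have hu' : Tendsto (fun k => ((u k).1 : LocalConfig (EuclideanSpace ℝ (Fin 3)))) atTop
        (𝓝 (S.1 : LocalConfig (EuclideanSpace ℝ (Fin 3)))) := tendsto_subtype_rng.1 hu
    obtain ⟨k, hk⟩ := ((tendsto_iff_locallyMatches.1 hu') M ε hε).exists
    obtain ⟨m, hm₀, a, hdeep, hk_eq⟩ := huA k
    refine ⟨m, hm₀, a, hdeep, ?_⟩
    rw [hk_eq] at hk
    change LocallyMatches (M : ℝ) ε
      (atoms (S.1 : LocalConfig (EuclideanSpace ℝ (Fin 3))).toMeasure) _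
    rw [atoms_toMeasure]
    exact hk


/-- **Stub S2 `stub_localLimitEngine` of the line «truncated-bs» on `TexturedLawTransfer`**
(statement verbatim): along any sequence of `δ`-separated configurations with windows
`B(x_{i_m}, r_m)` (`r_m → ∞`, `0 ≤ r_m`) whose `L_m`-boundary shells are `ε_m`-thin (`L_m → ∞`,
`ε_m → 0`), the uniformly rooted empirical laws of the windows have a subsequential local limit
`P` which is a point-stationary law of rooted `δ`-hard-core configurations, with
`E_P[rootEnergy] ≤ c` whenever the window double sums are eventually `≤ c · 2 · #window`, and
`P`-a.e. configuration is, at every radius `R` and precision `ε`, infinitely often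
`(R, ε)`-matched by the configuration recentred at an `R`-deep window point.
Proof: `exists_windowLimit` on the re-indexed windows. [folklore] -/
theorem stub_localLimitEngine :
    ∀ δ : ℝ, 0 < δ → ∀ x : (N : ℕ) → (Fin N → EuclideanSpace ℝ (Fin 3)), ∀ (Nw : ℕ → ℕ) (iw : (m :
      ℕ) → Fin (Nw m)) (rw Lw εw : ℕ → ℝ), (∀ m : ℕ, (∀ a b : Fin (Nw m), a ≠ b → δ ≤ dist (x (Nw
      m) a) (x (Nw m) b))) → (∀ m : ℕ, 0 ≤ rw m) → Filter.Tendsto rw Filter.atTop Filter.atTop →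
      Filter.Tendsto Lw Filter.atTop Filter.atTop → Filter.Tendsto εw Filter.atTop (nhds 0) → (∀ m
      : ℕ, (((Finset.univ.filter (fun j : Fin (Nw m) => rw m - Lw m < dist (x (Nw m) j) (x (Nw m)
      (iw m)) ∧ dist (x (Nw m) j) (x (Nw m) (iw m)) ≤ rw m))).card : ℝ) ≤ εw m *
      (((Finset.univ.filter (fun j : Fin (Nw m) => dist (x (Nw m) j) (x (Nw m) (iw m)) ≤ rw
      m))).card : ℝ)) → ∃ P : MeasureTheory.Measure (MeasureTheory.Measure (EuclideanSpace ℝ (Fin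
      3))), MeasureTheory.IsProbabilityMeasure P ∧ (∀ᵐ μ ∂P,
      Literature.Probability.Process.IsRootedHardCore δ μ) ∧
      Literature.Probability.Process.IsPointStationaryLaw P ∧ (∀ c : ℝ, (∀ᶠ m in Filter.atTop, (∑
      j ∈ (Finset.univ.filter (fun j : Fin (Nw m) => dist (x (Nw m) j) (x (Nw m) (iw m)) ≤ rw m)),
      ∑ k ∈ (Finset.univ.filter (fun j : Fin (Nw m) => dist (x (Nw m) j) (x (Nw m) (iw m)) ≤ rw
      m)), Literature.MathematicalPhysics.StatisticalMechanics.lennardJones (dist (x (Nw m) k) (x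
      (Nw m) j))) ≤ c * (2 * (((Finset.univ.filter (fun j : Fin (Nw m) => dist (x (Nw m) j) (x (Nw
      m) (iw m)) ≤ rw m))).card : ℝ))) → (∫ μ,
      Literature.MathematicalPhysics.StatisticalMechanics.rootEnergy
      Literature.MathematicalPhysics.StatisticalMechanics.lennardJones μ ∂P) ≤ c) ∧ (∀ᵐ μ ∂P, ∀ R
      ε : ℝ, 0 < ε → ∀ m₀ : ℕ, ∃ m : ℕ, m₀ ≤ m ∧ ∃ j : Fin (Nw m), dist (x (Nw m) j) (x (Nw m) (iw
      m)) + R ≤ rw m ∧ (∀ p : EuclideanSpace ℝ (Fin 3), μ {p} ≠ 0 → ‖p‖ ≤ R → ∃ k : Fin (Nw m),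
      dist (x (Nw m) k - x (Nw m) j) p ≤ ε) ∧ (∀ k : Fin (Nw m), dist (x (Nw m) k) (x (Nw m) j) ≤
      R → ∃ p : EuclideanSpace ℝ (Fin 3), μ {p} ≠ 0 ∧ dist (x (Nw m) k - x (Nw m) j) p ≤ ε)) := by
  intro δ hδ x Nw iw rw Lw εw hsep hrw0 hrw hLw hεw hshell
  -- name the windows `B m` and enumerate them increasingly by `f m`
  obtain ⟨B, hB⟩ : ∃ B : (m : ℕ) → Finset (Fin (Nw m)), ∀ m : ℕ, Finset.univ.filter
      (fun j : Fin (Nw m) => dist (x (Nw m) j) (x (Nw m) (iw m)) ≤ rw m) = B m :=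
    ⟨_, fun _ => rfl⟩
  simp only [hB] at hshell ⊢
  have hmemB : ∀ (m : ℕ) (j : Fin (Nw m)), dist (x (Nw m) j) (x (Nw m) (iw m)) ≤ rw m →
      j ∈ B m := fun m j hj => by
    rw [← hB]; exact Finset.mem_filter.2 ⟨Finset.mem_univ _, hj⟩
  have hBle : ∀ (m : ℕ) (j : Fin (Nw m)), j ∈ B m →
      dist (x (Nw m) j) (x (Nw m) (iw m)) ≤ rw m := fun m j hj => by
    rw [← hB] at hj; exact (Finset.mem_filter.1 hj).2
  have hn : ∀ m : ℕ, (B m).card ≠ 0 := fun m =>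
    Finset.card_ne_zero_of_mem (hmemB m (iw m) (by rw [dist_self]; exact hrw0 m))
  obtain ⟨f, hf⟩ : ∃ f : (m : ℕ) → (Fin (B m).card ↪o Fin (Nw m)),
      ∀ m : ℕ, f m = (B m).orderEmbOfFin rfl := ⟨_, fun _ => rfl⟩
  have hfmem : ∀ (m : ℕ) (a : Fin (B m).card), f m a ∈ B m := fun m a => by
    rw [hf]; exact Finset.orderEmbOfFin_mem _ _ _
  have hfsurj : ∀ (m : ℕ) (j : Fin (Nw m)), j ∈ B m → ∃ a : Fin (B m).card, f m a = j := by
    intro m j hj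
    have h := Finset.range_orderEmbOfFin (B m) rfl
    rw [← hf m] at h
    have hj' : j ∈ Set.range (f m) := by rw [h]; exact Finset.mem_coe.2 hj
    exact hj'
  have hmap : ∀ m : ℕ, Finset.univ.map (f m).toEmbedding = B m := fun m => by
    rw [hf]; exact Finset.map_orderEmbOfFin_univ _ _
  have hsepw : ∀ (m : ℕ) (a b : Fin (B m).card), a ≠ b →
      δ ≤ dist (x (Nw m) (f m a)) (x (Nw m) (f m b)) := fun m a b hab =>
    hsep m (f m a) (f m b) fun h => hab ((f m).injective h)
  have hεw0 : ∀ m : ℕ, 0 ≤ εw m := fun m => by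
    by_contra hneg
    have hpos : (0 : ℝ) < (B m).card := Nat.cast_pos.2 (Nat.pos_of_ne_zero (hn m))
    have h2 : εw m * (B m).card < 0 := mul_neg_of_neg_of_pos (not_le.1 hneg) hpos
    exact absurd ((hshell m).trans_lt h2) (not_lt.2 (Nat.cast_nonneg _))
  -- thin shells: the non-`M`-deep window points lie in the `L m`-shell once `M ≤ L m`
  have hthin : ∀ M : ℕ, ∀ᶠ m in atTop, ((Finset.univ.filter fun a : Fin (B m).card =>
      rw m < dist (x (Nw m) (f m a)) (x (Nw m) (iw m)) + M).card : ℝ) ≤ εw m * (B m).card := by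
    intro M
    filter_upwards [hLw.eventually_ge_atTop (M : ℝ)] with m hM
    refine le_trans (Nat.cast_le.2 (Finset.card_le_card_of_injOn (fun a => f m a)
      (fun a ha => ?_) fun a _ b _ h => (f m).injective h)) (hshell m)
    rw [Finset.mem_coe, Finset.mem_filter] at ha ⊢
    exact ⟨Finset.mem_univ _, by linarith [ha.2], hBle m _ (hfmem m a)⟩
  -- the engine
  obtain ⟨P, hP, hcore, hstat, henergy, hsupp⟩ := exists_windowLimit hδ (fun m => (B m).card) hn
    (fun m a => x (Nw m) (f m a)) hsepw (fun m => x (Nw m) (iw m)) rw εw hεw0 hεw hthin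
  refine ⟨P, hP, hcore, hstat, fun c hc => henergy c ?_, ?_⟩
  · -- window double sums are `2 · 𝓔(window)`
    filter_upwards [hc] with m hm
    have h2 := sum_sum_map_eq_two_mul_interactionEnergy lennardJones lennardJones_zero (x (Nw m))
      (f m).toEmbedding
    rw [hmap] at h2
    rw [Finset.sum_comm, h2] at hm
    have hm' : 2 * interactionEnergy lennardJones (fun a => x (Nw m) (f m a)) ≤
        c * (2 * ((B m).card : ℝ)) := hm
    change interactionEnergy lennardJones (fun a => x (Nw m) (f m a)) ≤ c * ((B m).card : ℝ)
    linarith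
  · -- local matching at integer depth `⌈max R 0⌉₊`, unpacked
    filter_upwards [hsupp] with μ hμ
    intro R ε hε m₀
    obtain ⟨m, hm, a, hdeep, hmatch⟩ := hμ ⌈max R 0⌉₊ m₀ ε hε
    have hRM : R ≤ (⌈max R 0⌉₊ : ℝ) := (le_max_left R 0).trans (Nat.le_ceil _)
    refine ⟨m, hm, f m a, by linarith, fun p hp hpR => ?_, fun k hk => ?_⟩
    · obtain ⟨_, ⟨b, rfl⟩, hq⟩ := hmatch.2 p hp (hpR.trans hRM)
      exact ⟨f m b, by rw [dist_comm]; exact hq⟩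
    · have hkB : k ∈ B m := hmemB m k (by
        linarith [dist_triangle (x (Nw m) k) (x (Nw m) (f m a)) (x (Nw m) (iw m))])
      obtain ⟨b, hb⟩ := hfsurj m k hkB
      subst hb
      obtain ⟨q, hq, hd⟩ := hmatch.1 (x (Nw m) (f m b) - x (Nw m) (f m a)) ⟨b, rfl⟩
        (by rw [← dist_eq_norm]; exact hk.trans hRM)
      exact ⟨q, hq, by rw [dist_comm]; exact hd⟩

end Summit.AtomisticToContinuum.Crystallization.Theorems.FrustratedLawDichotomyLocalLimitEngine

end
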